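import Summits.QuantumFields.YangMills.Theorems.LangevinControlUVOSLegsAtWeakCouplingCStubLocalityBumps
import HarnessLib

/-!
# Gap coordinates of a configuration of `q + 2` points of `ℝ⁴` (E1-locality, lead's rebuild — file A)

Helper file for stub `stub_locality` of crux `OSLegsAtWeakCouplingC` (stmt-QuantumFields-16207, line `Sketch`,
continuation lead c2; it replaces the unreadable pending `…StubLocalityConf` of the first lead).

A configuration of `m = q + 2` points of `ℝ⁴` all of whose coordinates are pairwise distinct along every axis is,
up to a translation, described by the orderings `σ μ : Fin (q+2) ≃ Fin (q+2)` (rank ↦ point) of its points along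
the four axes together with the `4(q+1) = 4q+3+1` consecutive GAPS; writing every gap as `ε + uⱼ` with a base gap
`ε > 0` and `u ≥ 0`, the closed orthant `{u ≥ 0}` parametrises configurations whose points stay `ε`-separated
along every axis — exactly the domain on which the Osterwalder–Schrader sector engine
(`LogSlot.exists_holomorphic_extension_sectorRegion`) is run by the later files.

* `gapEquiv q : Fin (4q+3+1) ≃ Fin 4 × Fin (q+1)` (gap index ↔ (axis, level));
* `cum ε u μ p` — the coordinate along axis `μ` of the point of rank `p`: `Σ_{g < p} (ε + u_{(μ,g)})`;
* `conf ε σ u : Fin (q+2) → ℝ⁴` — the configuration; `conf_apply`, `conf_rank`;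
* monotonicity and separation on the closed orthant (`cum_sub_cum_ge`, `le_abs_conf_sub_conf`, `sepCenters_conf`);
* continuity in the gaps (`continuous_cum`, `continuous_conf`);
* the ONE-GAP VARIATION `conf_insertNth`: raising the gap `j = (μ, g)` by `x` translates exactly the points of rank
  `> g` along axis `μ` by `x` (the geometric fact behind the one-slot continuations).
-/

set_option autoImplicit false

noncomputable section

open scoped BigOperators
open Literature.MathematicalPhysics.QuantumLattice

namespace Summit.QuantumFields.YangMills.Theorems.OSLegsAtWeakCouplingC.Loc

variable {q : ℕ}

/-! ### Gap indices -/

/-- Gap index `j : Fin (4q+3+1)` ↔ (axis `μ : Fin 4`, level `g : Fin (q+1)`). -/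
def gapEquiv (q : ℕ) : Fin (4 * q + 3 + 1) ≃ Fin 4 × Fin (q + 1) :=
  (finCongr (by ring : 4 * q + 3 + 1 = 4 * (q + 1))).trans finProdFinEquiv.symm

/-- The gap index of (axis, level). -/
abbrev gidx (q : ℕ) (μ : Fin 4) (g : Fin (q + 1)) : Fin (4 * q + 3 + 1) := (gapEquiv q).symm (μ, g)

/-- `gapEquiv` of `gidx`. -/
@[simp] theorem gapEquiv_gidx (μ : Fin 4) (g : Fin (q + 1)) : gapEquiv q (gidx q μ g) = (μ, g) :=
  Equiv.apply_symm_apply _ _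

/-- `gidx` of `gapEquiv`. -/
@[simp] theorem gidx_gapEquiv (j : Fin (4 * q + 3 + 1)) : gidx q (gapEquiv q j).1 (gapEquiv q j).2 = j :=
  Equiv.symm_apply_apply _ _

/-- `gidx` is injective in the pair. -/
theorem gidx_eq_iff {μ μ' : Fin 4} {g g' : Fin (q + 1)} : gidx q μ g = gidx q μ' g' ↔ μ = μ' ∧ g = g' := by
  rw [Equiv.apply_eq_iff_eq, Prod.mk.injEq]

/-! ### Cumulative coordinates -/

/-- **Coordinate along axis `μ` of the point of rank `p`**: the sum of the gaps `ε + u_{(μ,g)}` below level `p`. -/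
def cum (ε : ℝ) (u : Fin (4 * q + 3 + 1) → ℝ) (μ : Fin 4) (p : ℕ) : ℝ :=
  ∑ g : Fin (q + 1), if (g : ℕ) < p then ε + u (gidx q μ g) else 0

/-- Rank `0` sits at coordinate `0`. -/
@[simp] theorem cum_zero (ε : ℝ) (u : Fin (4 * q + 3 + 1) → ℝ) (μ : Fin 4) : cum ε u μ 0 = 0 := by
  simp [cum]

/-- One more level adds one gap. -/
theorem cum_succ (ε : ℝ) (u : Fin (4 * q + 3 + 1) → ℝ) (μ : Fin 4) (g : Fin (q + 1)) :
    cum ε u μ ((g : ℕ) + 1) = cum ε u μ g + (ε + u (gidx q μ g)) := by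
  unfold cum
  have h : ∀ g' : Fin (q + 1), (if (g' : ℕ) < (g : ℕ) + 1 then ε + u (gidx q μ g') else 0) =
      (if (g' : ℕ) < (g : ℕ) then ε + u (gidx q μ g') else 0) + (if g' = g then ε + u (gidx q μ g') else 0) := by
    intro g'
    by_cases h1 : (g' : ℕ) < (g : ℕ)
    · have h2 : g' ≠ g := fun h => by simp [h] at h1
      simp [h1, h2, Nat.lt_succ_of_lt h1]
    · by_cases h2 : g' = g
      · subst h2; simp
      · have h3 : ¬ (g' : ℕ) < (g : ℕ) + 1 := fun h => by
          have : (g' : ℕ) = g := by omega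
          exact h2 (Fin.ext this)
        simp [h1, h2, h3]
  simp_rw [h]
  rw [Finset.sum_add_distrib, Finset.sum_ite_eq' Finset.univ g]
  simp

/-- The difference of two cumulative coordinates is the sum of the gaps in between. -/
theorem cum_sub_cum (ε : ℝ) (u : Fin (4 * q + 3 + 1) → ℝ) (μ : Fin 4) {p p' : ℕ} (hpp' : p ≤ p') :
    cum ε u μ p' - cum ε u μ p =
      ∑ g : Fin (q + 1), if p ≤ (g : ℕ) ∧ (g : ℕ) < p' then ε + u (gidx q μ g) else 0 := by
  unfold cum
  rw [← Finset.sum_sub_distrib]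
  refine Finset.sum_congr rfl fun g _ => ?_
  by_cases h1 : (g : ℕ) < p
  · have h2 : (g : ℕ) < p' := lt_of_lt_of_le h1 hpp'
    simp [h1, h2]
  · by_cases h2 : (g : ℕ) < p'
    · have h3 : p ≤ (g : ℕ) ∧ (g : ℕ) < p' := ⟨by omega, h2⟩
      simp [h1, h3]
    · simp [h1, h2]

/-- **Monotonicity on the closed orthant**: between ranks `p ≤ p' ≤ q + 1` there are `p' − p` gaps, each `≥ ε`. -/
theorem cum_sub_cum_ge (ε : ℝ) {u : Fin (4 * q + 3 + 1) → ℝ} (hu : ∀ l, 0 ≤ u l) (μ : Fin 4)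
    {p p' : ℕ} (hpp' : p ≤ p') (hp' : p' ≤ q + 1) :
    ((p' : ℝ) - p) * ε ≤ cum ε u μ p' - cum ε u μ p := by
  classical
  rw [cum_sub_cum ε u μ hpp']
  -- compare with the sum of `ε` over the same levels
  have hcount : ∑ g : Fin (q + 1), (if p ≤ (g : ℕ) ∧ (g : ℕ) < p' then ε else 0) = ((p' : ℝ) - p) * ε := by
    rw [Finset.sum_ite, Finset.sum_const_zero, add_zero, Finset.sum_const, nsmul_eq_mul]
    congr 1
    have hcard : (Finset.univ.filter fun g : Fin (q + 1) => p ≤ (g : ℕ) ∧ (g : ℕ) < p').card = p' - p := by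
      have h1 : (Finset.univ.filter fun g : Fin (q + 1) => p ≤ (g : ℕ) ∧ (g : ℕ) < p') =
          (Finset.Ico p p').attachFin (fun n hn => by
            have := (Finset.mem_Ico.1 hn).2; omega) := by
        ext g
        simp [Finset.mem_attachFin, Finset.mem_Ico]
      rw [h1, Finset.card_attachFin, Nat.card_Ico]
    rw [hcard, Nat.cast_sub hpp']
  rw [← hcount]
  refine Finset.sum_le_sum fun g _ => ?_
  split_ifs
  · linarith [hu (gidx q μ g)]
  · exact le_rfl

/-- Consequently distinct ranks are at least `ε` apart. -/
theorem le_abs_cum_sub_cum {ε : ℝ} (hε : 0 ≤ ε) {u : Fin (4 * q + 3 + 1) → ℝ} (hu : ∀ l, 0 ≤ u l) (μ : Fin 4)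
    {p p' : ℕ} (hne : p ≠ p') (hp : p ≤ q + 1) (hp' : p' ≤ q + 1) :
    ε ≤ |cum ε u μ p' - cum ε u μ p| := by
  rcases Nat.lt_or_gt_of_ne hne with h | h
  · have h1 := cum_sub_cum_ge ε hu μ h.le hp'
    have h2 : (1 : ℝ) ≤ (p' : ℝ) - p := by
      have : (p : ℝ) + 1 ≤ p' := by exact_mod_cast h
      linarith
    rw [abs_of_nonneg (by nlinarith)]
    nlinarith
  · have h1 := cum_sub_cum_ge ε hu μ h.le hp
    have h2 : (1 : ℝ) ≤ (p : ℝ) - p' := by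
      have : (p' : ℝ) + 1 ≤ p := by exact_mod_cast h
      linarith
    rw [abs_sub_comm, abs_of_nonneg (by nlinarith)]
    nlinarith

/-- Continuity of the cumulative coordinates in the gaps. -/
theorem continuous_cum (ε : ℝ) (μ : Fin 4) (p : ℕ) : Continuous fun u : Fin (4 * q + 3 + 1) → ℝ => cum ε u μ p := by
  unfold cum
  refine continuous_finsetSum _ fun g _ => ?_
  split_ifs
  · exact continuous_const.add (continuous_apply _)
  · exact continuous_const

/-! ### The configuration -/

/-- **The configuration with orderings `σ` and gaps `ε + u`**: the point `i` has, along axis `μ`, rank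
`(σ μ)⁻¹ i` and coordinate `cum ε u μ ((σ μ)⁻¹ i)`. -/
def conf (ε : ℝ) (σ : Fin 4 → Equiv.Perm (Fin (q + 2))) (u : Fin (4 * q + 3 + 1) → ℝ) (i : Fin (q + 2)) :
    EuclideanSpace ℝ (Fin 4) :=
  WithLp.toLp 2 fun μ => cum ε u μ ((σ μ).symm i : ℕ)

/-- Coordinates of the configuration. -/
@[simp] theorem conf_apply (ε : ℝ) (σ : Fin 4 → Equiv.Perm (Fin (q + 2))) (u : Fin (4 * q + 3 + 1) → ℝ)
    (i : Fin (q + 2)) (μ : Fin 4) : conf ε σ u i μ = cum ε u μ ((σ μ).symm i : ℕ) := rfl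

/-- The point of rank `p` along axis `μ` has `μ`-coordinate `cum ε u μ p`. -/
theorem conf_rank (ε : ℝ) (σ : Fin 4 → Equiv.Perm (Fin (q + 2))) (u : Fin (4 * q + 3 + 1) → ℝ)
    (μ : Fin 4) (p : Fin (q + 2)) : conf ε σ u (σ μ p) μ = cum ε u μ p := by
  rw [conf_apply, Equiv.symm_apply_apply]

/-- Continuity of the configuration in the gaps. -/
theorem continuous_conf (ε : ℝ) (σ : Fin 4 → Equiv.Perm (Fin (q + 2))) :
    Continuous fun u : Fin (4 * q + 3 + 1) → ℝ => conf ε σ u := by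
  refine continuous_pi fun i => ?_
  refine (PiLp.continuous_toLp 2 _).comp ?_
  exact continuous_pi fun μ => continuous_cum ε μ _

/-- **Separation along every axis on the closed orthant**: distinct points are at least `ε` apart in every
coordinate. -/
theorem le_abs_conf_sub_conf {ε : ℝ} (hε : 0 ≤ ε) (σ : Fin 4 → Equiv.Perm (Fin (q + 2)))
    {u : Fin (4 * q + 3 + 1) → ℝ} (hu : ∀ l, 0 ≤ u l) {i j : Fin (q + 2)} (hij : i ≠ j) (μ : Fin 4) :
    ε ≤ |conf ε σ u i μ - conf ε σ u j μ| := by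
  rw [conf_apply, conf_apply, abs_sub_comm]
  refine le_abs_cum_sub_cum hε hu μ (fun h => hij ?_) (by omega) (by omega)
  exact (σ μ).symm.injective (Fin.ext h)

/-- **The configuration is `r`-separated for `2r < ε`** (on the closed orthant). -/
theorem sepCenters_conf {ε r : ℝ} (hε : 0 ≤ ε) (hr : 2 * r < ε) (σ : Fin 4 → Equiv.Perm (Fin (q + 2)))
    {u : Fin (4 * q + 3 + 1) → ℝ} (hu : ∀ l, 0 ≤ u l) : SepCenters r (conf ε σ u) := by
  intro i j hij
  have h1 := le_abs_conf_sub_conf hε σ hu hij 0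
  have h2 := abs_apply_zero_sub_le (conf ε σ u i) (conf ε σ u j)
  linarith

/-! ### The one-gap variation -/

/-- Inserting at `j`: the value at `j` is the inserted one, elsewhere it does not depend on it. -/
theorem insertNth_apply_eq (j : Fin (4 * q + 3 + 1)) (x : ℝ) (u' : Fin (4 * q + 3) → ℝ) (l : Fin (4 * q + 3 + 1)) :
    (j.insertNth x u' : Fin (4 * q + 3 + 1) → ℝ) l =
      (if l = j then x else 0) + (j.insertNth (0 : ℝ) u' : Fin (4 * q + 3 + 1) → ℝ) l := by
  induction l using Fin.succAboveCases j with
  | x => simp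
  | p l' =>
      have hne : j.succAbove l' ≠ j := Fin.succAbove_ne j l'
      simp [Fin.insertNth_apply_succAbove, hne]

/-- **One-gap variation of the cumulative coordinates**: raising the gap `j = (μ₀, g₀)` from `0` to `x` raises the
`μ₀`-coordinates of the ranks above `g₀` by `x` and nothing else. -/
theorem cum_insertNth (ε : ℝ) (j : Fin (4 * q + 3 + 1)) (x : ℝ) (u' : Fin (4 * q + 3) → ℝ) (μ : Fin 4) (p : ℕ) :
    cum ε (j.insertNth x u') μ p =
      cum ε (j.insertNth (0 : ℝ) u') μ p + (if (gapEquiv q j).1 = μ ∧ ((gapEquiv q j).2 : ℕ) < p then x else 0) := by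
  classical
  unfold cum
  have hterm : ∀ g : Fin (q + 1),
      (if (g : ℕ) < p then ε + (j.insertNth x u' : Fin (4 * q + 3 + 1) → ℝ) (gidx q μ g) else 0) =
      (if (g : ℕ) < p then ε + (j.insertNth (0 : ℝ) u' : Fin (4 * q + 3 + 1) → ℝ) (gidx q μ g) else 0) +
        (if (g : ℕ) < p ∧ gidx q μ g = j then x else 0) := by
    intro g
    rw [insertNth_apply_eq]
    by_cases h1 : (g : ℕ) < p <;> by_cases h2 : gidx q μ g = j <;> simp [h1, h2]
  simp_rw [hterm]
  rw [Finset.sum_add_distrib]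
  congr 1
  -- the extra term is present iff `j = (μ, g)` with `g < p`
  by_cases hμ : (gapEquiv q j).1 = μ
  · have hj : ∀ g : Fin (q + 1), gidx q μ g = j ↔ g = (gapEquiv q j).2 := by
      intro g
      constructor
      · intro h; have := congrArg (gapEquiv q) h; rw [gapEquiv_gidx] at this; rw [← this]
      · intro h; subst h; rw [← hμ, gidx_gapEquiv]
    simp_rw [hj]
    rw [Finset.sum_ite, Finset.sum_const_zero, add_zero, Finset.sum_const, nsmul_eq_mul]
    by_cases hp : ((gapEquiv q j).2 : ℕ) < p
    · have hcard : (Finset.univ.filter fun g : Fin (q + 1) => (g : ℕ) < p ∧ g = (gapEquiv q j).2).card = 1 := by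
        rw [Finset.card_eq_one]
        refine ⟨(gapEquiv q j).2, ?_⟩
        ext g
        simp only [Finset.mem_filter, Finset.mem_univ, true_and, Finset.mem_singleton]
        exact ⟨fun h => h.2, fun h => ⟨h ▸ hp, h⟩⟩
      rw [hcard]; simp [hμ, hp]
    · have hcard : (Finset.univ.filter fun g : Fin (q + 1) => (g : ℕ) < p ∧ g = (gapEquiv q j).2).card = 0 := by
        rw [Finset.card_eq_zero, Finset.filter_eq_empty_iff]
        rintro g - ⟨hg, rfl⟩; exact hp hg
      rw [hcard]; simp [hp]
  · have hj : ∀ g : Fin (q + 1), gidx q μ g ≠ j := by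
      intro g h; apply hμ; have := congrArg (gapEquiv q) h; rw [gapEquiv_gidx] at this; rw [← this]
    simp [hj, hμ]

/-- **One-gap variation of the configuration**: `conf ε σ (j.insertNth x u') i` is `conf ε σ (j.insertNth 0 u') i`
translated by `x e_{μ₀}` when the rank of `i` along the axis `μ₀` of `j` exceeds the level of `j`, and unchanged
otherwise. -/
theorem conf_insertNth (ε : ℝ) (σ : Fin 4 → Equiv.Perm (Fin (q + 2))) (j : Fin (4 * q + 3 + 1)) (x : ℝ)
    (u' : Fin (4 * q + 3) → ℝ) (i : Fin (q + 2)) :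
    conf ε σ (j.insertNth x u') i = conf ε σ (j.insertNth (0 : ℝ) u') i +
      (if ((gapEquiv q j).2 : ℕ) < ((σ (gapEquiv q j).1).symm i : ℕ) then x else 0) •
        EuclideanSpace.single (gapEquiv q j).1 (1 : ℝ) := by
  ext μ
  rw [conf_apply, cum_insertNth, PiLp.add_apply, PiLp.smul_apply, conf_apply, EuclideanSpace.single,
    PiLp.single_apply, smul_eq_mul]
  by_cases hμ : (gapEquiv q j).1 = μ
  · subst hμ; simp
  · have hμ' : ¬ μ = (gapEquiv q j).1 := fun h => hμ h.symm
    simp [hμ, hμ']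

end Summit.QuantumFields.YangMills.Theorems.OSLegsAtWeakCouplingC.Loc

end
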